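import Mathlib.LinearAlgebra.Projection
import Mathlib.LinearAlgebra.Basis.VectorSpace
import Mathlib.LinearAlgebra.FiniteDimensional.Lemmas
import Mathlib.Data.Fintype.Lattice
import Summits.HodgeConjecture.CorCM.IrreducibleOddWeightsShadowModulesOneSided
import HarnessLib

/-!
# Isotypic cells, I: stable IRREDUCIBLE subspaces for a family of operators — irreducible subspaces exist,
# COMPLEMENTS by independent subfamilies, equivariant PROJECTIONS, DIMENSION QUANTISATION

COR-CM (cell `pub-hodgecm2`, binder seat `b16` gen 70, count-neutral claim ISOTYPIC SPLITTING OF THE DEFECT, file I1 —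
pure linear algebra; theorems only, no definition, no named fact, no `sorry`).  NEW as organised here, hence under
`Summits/`.  HONEST FRAMING: the elementary theory of «semisimple modules» written for ONE ℚ-vector space `V` carrying a
FAMILY of linear operators `T_i` (no group, no algebra, no Maschke), in the unbundled shape the lane uses everywhere:
`N` STABLE = `∀ i v, v ∈ N → T_i v ∈ N`; `N` IRREDUCIBLE = every stable `0 ≠ W ≤ N` equals `N` (so `⊥` is irreducible).
Three instances serve the lane: the translates `f ↦ f(k·)` on `ℚ^{Y}` (shadow modules `A ≤ ℚ^{Y}`), the LEFT translations
`c ↦ c(k·)` and the RIGHT translations `c ↦ c(·k)` on `ℚ^G` (coefficient cells, shadow-coefficient spaces `S(w)`).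
`HC_CM` is neither used nor asserted; nothing here mentions CM fields.

* §1 Stability is inherited by `⊓`, `⊔`, finite `sup`, `⨆`.
* §2 **IRREDUCIBLES EXIST** (`exists_irreducible_le_of_stable`): a non-zero finite-dimensional stable subspace contains a
  non-zero stable irreducible one (a stable subspace of least positive dimension).
* §3 **COMPLEMENTS** (`exists_finset_compl_of_stable_le_iSup`): `N_s` (`s ∈ σ` finite) stable irreducible, `M` stable,
  `M ≤ Σ_s N_s` ⟹ there is `S ⊆ σ` with **`M ⊓ Σ_{s∈S} N_s = 0`, `M + Σ_{s∈S} N_s = Σ_s N_s` and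
  `dim(M + Σ_{s∈S} N_s) = dim M + Σ_{s∈S} dim N_s`** (greedy: a maximal `S` with these properties absorbs every `N_t`,
  because an irreducible `N_t` either lies in a stable subspace or meets it trivially); `M = 0`: an INDEPENDENT spanning
  subfamily (`exists_finset_sup_eq_iSup_finrank_eq_sum`).
* §4 **DIMENSION QUANTISATION** (`dvd_finrank_of_stable_le_iSup`): if every `N_s` is `0` or of dimension `d`, then
  **`d ∣ dim M` for EVERY stable `M ≤ Σ_s N_s`** (`dim M = Σ_{S₀} dim N_s − Σ_{S} dim N_s`).
* §5 **EQUIVARIANT PROJECTIONS** (`exists_proj_of_inf_eq_bot`): `P, Q` stable with `P ⊓ Q = 0` ⟹ a linear `π : V → V`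
  with `π(V) ⊆ P`, `π = id` on `P`, `π = 0` on `Q`, `v − π v ∈ Q` on `P ⊔ Q`, commuting with every `T_i` on `P ⊔ Q`.
File I2 (`IrreducibleOddWeightsIsotypicCellsIso`) continues with Jordan–Hölder-lite and cross-type independence.

## References

* [Serre1977] J.-P. Serre, *Linear Representations of Finite Groups*, GTM 42, §1.4 (complete reducibility: complements),
  §2.6 (canonical decomposition).
* [Lang2002] S. Lang, *Algebra*, 3rd ed., XVII §1 Prop. 1.1 (Schur) and XVII §2 (semisimple modules: a submodule of a sum
  of simple modules has a complement which is a sub-sum).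
* [CurtisReiner1962] C. W. Curtis, I. Reiner, *Representation Theory of Finite Groups and Associative Algebras*, §15.
-/

set_option autoImplicit false

noncomputable section

open scoped BigOperators Classical

universe u v w

namespace Summit.HodgeConjecture.CorCM.IrrOdd

variable {V : Type v} [AddCommGroup V] [Module ℚ V] {ι : Type w} (T : ι → V →ₗ[ℚ] V)

/-! ### §1 Stability under lattice operations -/

omit [AddCommGroup V] [Module ℚ V] in
/-- The meet of two stable subspaces is stable. [cite: Serre1977, §2.6] -/
theorem stable_inf [AddCommGroup V] [Module ℚ V] (T : ι → V →ₗ[ℚ] V) {P Q : Submodule ℚ V}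
    (hP : ∀ (i : ι) (v : V), v ∈ P → T i v ∈ P) (hQ : ∀ (i : ι) (v : V), v ∈ Q → T i v ∈ Q) :
    ∀ (i : ι) (v : V), v ∈ P ⊓ Q → T i v ∈ P ⊓ Q :=
  fun i v hv => ⟨hP i v hv.1, hQ i v hv.2⟩

/-- The join of two stable subspaces is stable. [cite: Serre1977, §2.6] -/
theorem stable_sup {P Q : Submodule ℚ V}
    (hP : ∀ (i : ι) (v : V), v ∈ P → T i v ∈ P) (hQ : ∀ (i : ι) (v : V), v ∈ Q → T i v ∈ Q) :
    ∀ (i : ι) (v : V), v ∈ P ⊔ Q → T i v ∈ P ⊔ Q := by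
  intro i v hv
  obtain ⟨p, hp, q, hq, rfl⟩ := Submodule.mem_sup.1 hv
  rw [map_add]
  exact Submodule.add_mem _ (Submodule.mem_sup_left (hP i p hp)) (Submodule.mem_sup_right (hQ i q hq))

/-- A finite `sup` of stable subspaces is stable. [cite: Serre1977, §2.6] -/
theorem stable_finset_sup {σ : Type u} (N : σ → Submodule ℚ V)
    (hN : ∀ (s : σ) (i : ι) (v : V), v ∈ N s → T i v ∈ N s) (S : Finset σ) :
    ∀ (i : ι) (v : V), v ∈ S.sup N → T i v ∈ S.sup N := by
  refine Finset.sup_induction (p := fun X : Submodule ℚ V => ∀ (i : ι) (v : V), v ∈ X → T i v ∈ X) ?_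
    (fun P hP Q hQ => stable_sup T hP hQ) (fun s _ => hN s)
  intro i v hv
  rw [(Submodule.mem_bot ℚ).1 hv, map_zero]
  exact Submodule.zero_mem _

/-- The `⨆` of a finite stable family is stable. [cite: Serre1977, §2.6] -/
theorem stable_iSup {σ : Type u} [Fintype σ] (N : σ → Submodule ℚ V)
    (hN : ∀ (s : σ) (i : ι) (v : V), v ∈ N s → T i v ∈ N s) :
    ∀ (i : ι) (v : V), v ∈ (⨆ s, N s) → T i v ∈ ⨆ s, N s := by
  rw [← Finset.sup_univ_eq_iSup]
  exact stable_finset_sup T N hN Finset.univ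

/-! ### §2 Irreducible stable subspaces exist -/

/-- **IRREDUCIBLES EXIST**: a non-zero finite-dimensional stable subspace `N` contains a non-zero stable subspace `N′`
which is IRREDUCIBLE (every non-zero stable `W ≤ N′` is `N′`) — a stable subspace of least positive dimension.
[cite: Lang2002, XVII §2] -/
theorem exists_irreducible_le_of_stable {N : Submodule ℚ V} [FiniteDimensional ℚ N]
    (hNst : ∀ (i : ι) (v : V), v ∈ N → T i v ∈ N) (hN : N ≠ ⊥) :
    ∃ N' : Submodule ℚ V, N' ≤ N ∧ N' ≠ ⊥ ∧ (∀ (i : ι) (v : V), v ∈ N' → T i v ∈ N') ∧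
      ∀ W : Submodule ℚ V, W ≤ N' → W ≠ ⊥ → (∀ (i : ι) (v : V), v ∈ W → T i v ∈ W) → W = N' := by
  have hex : ∃ n, ∃ W : Submodule ℚ V, W ≤ N ∧ W ≠ ⊥ ∧ (∀ (i : ι) (v : V), v ∈ W → T i v ∈ W) ∧
      Module.finrank ℚ W = n := ⟨_, N, le_rfl, hN, hNst, rfl⟩
  obtain ⟨W, hWN, hW0, hWst, hWn⟩ := Nat.find_spec hex
  refine ⟨W, hWN, hW0, hWst, fun W' hW'W hW'0 hW'st => ?_⟩
  haveI : FiniteDimensional ℚ W := Submodule.finiteDimensional_of_le hWN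
  have hmin := Nat.find_min' hex ⟨W', hW'W.trans hWN, hW'0, hW'st, rfl⟩
  exact Submodule.eq_of_le_of_finrank_le hW'W (hWn ▸ hmin)

/-! ### §3 Complements by independent subfamilies -/

/-- One greedy step: `X` stable, `N_t` stable irreducible and NOT contained in `X` ⟹ `N_t ⊓ X = 0`.
[cite: Lang2002, XVII §2] -/
theorem inf_eq_bot_of_irreducible_of_not_le {Nt X : Submodule ℚ V}
    (hNst : ∀ (i : ι) (v : V), v ∈ Nt → T i v ∈ Nt)
    (hNirr : ∀ W : Submodule ℚ V, W ≤ Nt → W ≠ ⊥ → (∀ (i : ι) (v : V), v ∈ W → T i v ∈ W) → W = Nt)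
    (hX : ∀ (i : ι) (v : V), v ∈ X → T i v ∈ X) (hle : ¬ Nt ≤ X) : Nt ⊓ X = ⊥ := by
  by_contra hne
  exact hle (inf_eq_left.1 (hNirr _ inf_le_left hne (stable_inf T hNst hX)))

/-- **COMPLEMENTS.**  `N_s` (`s ∈ σ`, `σ` finite) stable irreducible subspaces, `M` stable with `M ≤ Σ_s N_s`.  Then some
`S ⊆ σ` has `M ⊓ Σ_{s∈S} N_s = 0`, `M + Σ_{s∈S} N_s = Σ_s N_s` and `dim(M + Σ_{s∈S} N_s) = dim M + Σ_{s∈S} dim N_s`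
(so `M` and the `N_s`, `s ∈ S`, form an INDEPENDENT family spanning everything).  Greedy proof: take `S` of maximal size
with the first and third property; every `N_t` lies in the stable `M + Σ_S N_s`, for otherwise `N_t` meets it trivially and
`S ∪ {t}` would be admissible. [cite: Lang2002, XVII §2] [cite: Serre1977, §1.4] -/
theorem exists_finset_compl_of_stable_le_iSup {σ : Type u} [Fintype σ] {N : σ → Submodule ℚ V}
    [∀ s, FiniteDimensional ℚ (N s)]
    (hNst : ∀ (s : σ) (i : ι) (v : V), v ∈ N s → T i v ∈ N s)
    (hNirr : ∀ (s : σ) (W : Submodule ℚ V), W ≤ N s → W ≠ ⊥ →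
      (∀ (i : ι) (v : V), v ∈ W → T i v ∈ W) → W = N s)
    {M : Submodule ℚ V} [FiniteDimensional ℚ M] (hMst : ∀ (i : ι) (v : V), v ∈ M → T i v ∈ M)
    (hM : M ≤ ⨆ s, N s) :
    ∃ S : Finset σ, M ⊓ S.sup N = ⊥ ∧ M ⊔ S.sup N = ⨆ s, N s ∧
      Module.finrank ℚ ↥(M ⊔ S.sup N) = Module.finrank ℚ M + ∑ s ∈ S, Module.finrank ℚ (N s) := by
  -- admissible finsets
  set adm : Finset (Finset σ) := Finset.univ.filter fun S : Finset σ =>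
    M ⊓ S.sup N = ⊥ ∧ Module.finrank ℚ ↥(M ⊔ S.sup N) = Module.finrank ℚ M + ∑ s ∈ S, Module.finrank ℚ (N s)
    with hadm
  have hmem_adm : ∀ S : Finset σ, S ∈ adm ↔ M ⊓ S.sup N = ⊥ ∧
      Module.finrank ℚ ↥(M ⊔ S.sup N) = Module.finrank ℚ M + ∑ s ∈ S, Module.finrank ℚ (N s) := fun S => by
    rw [hadm, Finset.mem_filter]
    simp
  have h0 : (∅ : Finset σ) ∈ adm := by
    rw [hmem_adm, Finset.sup_empty, inf_bot_eq, sup_bot_eq]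
    simp
  obtain ⟨S, hS, hmax⟩ := Finset.exists_max_image adm Finset.card ⟨∅, h0⟩
  obtain ⟨hSdisj, hSdim⟩ := (hmem_adm S).1 hS
  -- the stable subspace `X = M ⊔ S.sup N` contains every `N_t`
  have hXst : ∀ (i : ι) (v : V), v ∈ M ⊔ S.sup N → T i v ∈ M ⊔ S.sup N :=
    stable_sup T hMst (stable_finset_sup T N hNst S)
  have hall : ∀ t : σ, N t ≤ M ⊔ S.sup N := by
    intro t
    by_contra hle
    have ht : t ∉ S := fun ht => hle ((Finset.le_sup ht).trans le_sup_right)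
    have hmeet : N t ⊓ (M ⊔ S.sup N) = ⊥ := inf_eq_bot_of_irreducible_of_not_le T (hNst t) (hNirr t) hXst hle
    -- `insert t S` is admissible, contradicting maximality
    have hins : insert t S ∈ adm := by
      rw [hmem_adm, Finset.sup_insert, Finset.sum_insert ht]
      constructor
      · rw [eq_bot_iff]
        intro x hx
        obtain ⟨hxM, hx'⟩ := Submodule.mem_inf.1 hx
        obtain ⟨n, hn, y, hy, hny⟩ := Submodule.mem_sup.1 hx'
        have hnmem : n ∈ N t ⊓ (M ⊔ S.sup N) := by
          refine ⟨hn, ?_⟩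
          have hn' : n = x - y := by rw [← hny]; abel
          rw [hn']
          exact Submodule.sub_mem _ (Submodule.mem_sup_left hxM) (Submodule.mem_sup_right hy)
        rw [hmeet, Submodule.mem_bot] at hnmem
        rw [hnmem, zero_add] at hny
        subst hny
        have hyM : y ∈ M ⊓ S.sup N := ⟨hxM, hy⟩
        rwa [hSdisj] at hyM
      · have hsup : M ⊔ (N t ⊔ S.sup N) = (M ⊔ S.sup N) ⊔ N t := by
          rw [sup_left_comm, sup_comm]
        have hdim := Submodule.finrank_sup_add_finrank_inf_eq (M ⊔ S.sup N) (N t)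
        rw [inf_comm, hmeet, finrank_bot, add_zero] at hdim
        rw [hsup, hdim, hSdim]
        ring
    have hcard := hmax _ hins
    rw [Finset.card_insert_of_notMem ht] at hcard
    omega
  refine ⟨S, hSdisj, le_antisymm (sup_le hM (Finset.sup_le fun s _ => le_iSup N s)) ?_, hSdim⟩
  exact iSup_le hall

/-- **AN INDEPENDENT SPANNING SUBFAMILY** (the case `M = 0`): some `S ⊆ σ` has `Σ_{s∈S} N_s = Σ_s N_s` and
`dim Σ_s N_s = Σ_{s∈S} dim N_s`. [cite: Lang2002, XVII §2] -/
theorem exists_finset_sup_eq_iSup_finrank_eq_sum {σ : Type u} [Fintype σ] {N : σ → Submodule ℚ V}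
    [∀ s, FiniteDimensional ℚ (N s)]
    (hNst : ∀ (s : σ) (i : ι) (v : V), v ∈ N s → T i v ∈ N s)
    (hNirr : ∀ (s : σ) (W : Submodule ℚ V), W ≤ N s → W ≠ ⊥ →
      (∀ (i : ι) (v : V), v ∈ W → T i v ∈ W) → W = N s) :
    ∃ S : Finset σ, S.sup N = ⨆ s, N s ∧
      Module.finrank ℚ ↥(⨆ s, N s) = ∑ s ∈ S, Module.finrank ℚ (N s) := by
  have hbot : ∀ (i : ι) (v : V), v ∈ (⊥ : Submodule ℚ V) → T i v ∈ (⊥ : Submodule ℚ V) := fun i v hv => by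
    rw [(Submodule.mem_bot ℚ).1 hv, map_zero]
    exact Submodule.zero_mem _
  obtain ⟨S, -, hsup, hdim⟩ := exists_finset_compl_of_stable_le_iSup T hNst hNirr hbot bot_le
  rw [bot_sup_eq] at hsup hdim
  rw [finrank_bot, zero_add] at hdim
  exact ⟨S, hsup, by rw [← hsup]; exact hdim⟩

/-- The complement in dimension form: `dim Σ_s N_s = dim M + Σ_{s∈S} dim N_s` for the `S` of
`exists_finset_compl_of_stable_le_iSup`. [cite: Lang2002, XVII §2] -/
theorem exists_finset_finrank_iSup_eq_finrank_add_sum {σ : Type u} [Fintype σ] {N : σ → Submodule ℚ V}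
    [∀ s, FiniteDimensional ℚ (N s)]
    (hNst : ∀ (s : σ) (i : ι) (v : V), v ∈ N s → T i v ∈ N s)
    (hNirr : ∀ (s : σ) (W : Submodule ℚ V), W ≤ N s → W ≠ ⊥ →
      (∀ (i : ι) (v : V), v ∈ W → T i v ∈ W) → W = N s)
    {M : Submodule ℚ V} [FiniteDimensional ℚ M] (hMst : ∀ (i : ι) (v : V), v ∈ M → T i v ∈ M)
    (hM : M ≤ ⨆ s, N s) :
    ∃ S : Finset σ, M ⊓ S.sup N = ⊥ ∧ M ⊔ S.sup N = ⨆ s, N s ∧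
      Module.finrank ℚ ↥(⨆ s, N s) = Module.finrank ℚ M + ∑ s ∈ S, Module.finrank ℚ (N s) := by
  obtain ⟨S, hdisj, hsup, hdim⟩ := exists_finset_compl_of_stable_le_iSup T hNst hNirr hMst hM
  exact ⟨S, hdisj, hsup, by rw [← hsup]; exact hdim⟩

/-! ### §4 Dimension quantisation -/

/-- **DIMENSION QUANTISATION.**  If every `N_s` is `0` or of dimension `d`, then `d ∣ dim M` for EVERY stable subspace
`M ≤ Σ_s N_s` (`dim M = Σ_{S₀} dim N_s − Σ_{S} dim N_s` for an independent spanning `S₀` and a complement `S`).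
[cite: Serre1977, §2.6] [cite: Lang2002, XVII §2] -/
theorem dvd_finrank_of_stable_le_iSup {σ : Type u} [Fintype σ] {N : σ → Submodule ℚ V}
    [∀ s, FiniteDimensional ℚ (N s)]
    (hNst : ∀ (s : σ) (i : ι) (v : V), v ∈ N s → T i v ∈ N s)
    (hNirr : ∀ (s : σ) (W : Submodule ℚ V), W ≤ N s → W ≠ ⊥ →
      (∀ (i : ι) (v : V), v ∈ W → T i v ∈ W) → W = N s)
    {d : ℕ} (hd : ∀ s, N s = ⊥ ∨ Module.finrank ℚ (N s) = d)
    {M : Submodule ℚ V} [FiniteDimensional ℚ M] (hMst : ∀ (i : ι) (v : V), v ∈ M → T i v ∈ M)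
    (hM : M ≤ ⨆ s, N s) : d ∣ Module.finrank ℚ M := by
  have hterm : ∀ s, d ∣ Module.finrank ℚ (N s) := fun s => by
    rcases hd s with h | h
    · rw [h, finrank_bot]; exact dvd_zero d
    · rw [h]
  obtain ⟨S₀, -, h₀⟩ := exists_finset_sup_eq_iSup_finrank_eq_sum T hNst hNirr
  obtain ⟨S, -, -, h₁⟩ := exists_finset_finrank_iSup_eq_finrank_add_sum T hNst hNirr hMst hM
  have hA : d ∣ ∑ s ∈ S₀, Module.finrank ℚ (N s) := Finset.dvd_sum fun s _ => hterm s
  have hB : d ∣ ∑ s ∈ S, Module.finrank ℚ (N s) := Finset.dvd_sum fun s _ => hterm s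
  have hsub := Nat.dvd_sub hA hB
  have heq : ∑ s ∈ S₀, Module.finrank ℚ (N s) - ∑ s ∈ S, Module.finrank ℚ (N s) = Module.finrank ℚ M := by
    rw [← h₀, h₁]; omega
  rwa [heq] at hsub

/-- In particular `d ∣ dim Σ_s N_s`. [cite: Serre1977, §2.6] -/
theorem dvd_finrank_iSup {σ : Type u} [Fintype σ] {N : σ → Submodule ℚ V} [∀ s, FiniteDimensional ℚ (N s)]
    (hNst : ∀ (s : σ) (i : ι) (v : V), v ∈ N s → T i v ∈ N s)
    (hNirr : ∀ (s : σ) (W : Submodule ℚ V), W ≤ N s → W ≠ ⊥ →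
      (∀ (i : ι) (v : V), v ∈ W → T i v ∈ W) → W = N s)
    {d : ℕ} (hd : ∀ s, N s = ⊥ ∨ Module.finrank ℚ (N s) = d) :
    d ∣ Module.finrank ℚ ↥(⨆ s, N s) :=
  dvd_finrank_of_stable_le_iSup T hNst hNirr hd (stable_iSup T N hNst) le_rfl

/-! ### §5 Equivariant projections -/

/-- **EQUIVARIANT PROJECTIONS.**  `P, Q` stable with `P ⊓ Q = 0`: there is a linear `π : V → V` with values in `P`, the
identity on `P`, zero on `Q`, `v − π v ∈ Q` for `v ∈ P ⊔ Q`, and `π (T_i v) = T_i (π v)` for `v ∈ P ⊔ Q` (the projection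
onto `P` along `Q ⊕ R` for any complement `R` of `P ⊔ Q`). [cite: Serre1977, §1.4 and §2.6] -/
theorem exists_proj_of_inf_eq_bot {P Q : Submodule ℚ V}
    (hP : ∀ (i : ι) (v : V), v ∈ P → T i v ∈ P) (hQ : ∀ (i : ι) (v : V), v ∈ Q → T i v ∈ Q) (hPQ : P ⊓ Q = ⊥) :
    ∃ π : V →ₗ[ℚ] V, (∀ v, π v ∈ P) ∧ (∀ v ∈ P, π v = v) ∧ (∀ v ∈ Q, π v = 0) ∧
      (∀ v ∈ P ⊔ Q, v - π v ∈ Q) ∧ ∀ (i : ι) (v : V), v ∈ P ⊔ Q → π (T i v) = T i (π v) := by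
  obtain ⟨R, hR⟩ := Submodule.exists_isCompl (P ⊔ Q)
  have hc : IsCompl P (Q ⊔ R) := by
    constructor
    · rw [disjoint_iff, eq_bot_iff]
      intro x hx
      obtain ⟨hxP, hxQR⟩ := Submodule.mem_inf.1 hx
      obtain ⟨q, hq, r, hr, hqr⟩ := Submodule.mem_sup.1 hxQR
      have hrmem : r ∈ (P ⊔ Q) ⊓ R := by
        refine ⟨?_, hr⟩
        have hr' : r = x - q := by rw [← hqr]; abel
        rw [hr']
        exact Submodule.sub_mem _ (Submodule.mem_sup_left hxP) (Submodule.mem_sup_right hq)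
      rw [hR.inf_eq_bot, Submodule.mem_bot] at hrmem
      rw [hrmem, add_zero] at hqr
      subst hqr
      have hq' : q ∈ P ⊓ Q := ⟨hxP, hq⟩
      rwa [hPQ] at hq'
    · rw [codisjoint_iff, ← sup_assoc]
      exact hR.sup_eq_top
  refine ⟨P.projection (Q ⊔ R) hc, fun v => Submodule.projection_apply_mem hc v,
    fun v hv => Submodule.projection_apply_of_mem_left hc hv,
    fun v hv => Submodule.projection_apply_of_mem_right hc (Submodule.mem_sup_left hv), fun v hv => ?_,
    fun i v hv => ?_⟩
  · obtain ⟨p, hp, q, hq, rfl⟩ := Submodule.mem_sup.1 hv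
    rw [map_add, Submodule.projection_apply_of_mem_left hc hp,
      Submodule.projection_apply_of_mem_right hc (Submodule.mem_sup_left hq)]
    simpa using hq
  · obtain ⟨p, hp, q, hq, rfl⟩ := Submodule.mem_sup.1 hv
    rw [map_add, map_add, map_add, Submodule.projection_apply_of_mem_left hc hp,
      Submodule.projection_apply_of_mem_right hc (Submodule.mem_sup_left hq), add_zero,
      Submodule.projection_apply_of_mem_left hc (hP i p hp),
      Submodule.projection_apply_of_mem_right hc (Submodule.mem_sup_left (hQ i q hq)), add_zero]

end Summit.HodgeConjecture.CorCM.IrrOdd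

end
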